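import Mathlib
import Literature.Probability.Percolation.DiagonalStripCharacterWheel
import HarnessLib

/-!
# IP12 (26)–(27): the exact recursion of the character polynomial `χ̂_L` on `U_{u+1} = ω U_u`

Topic `Literature/Probability/Percolation`. Ikhlef–Ponsaing (J. Stat. Phys. 149 (2012),
arXiv:1202.5476) Prop. 3.4 uses the recursion `χ_L(z_1, z_2 = q z_1, …) = E_L · χ_{L-2}(z_3, …)`
((26)–(27)). `DiagonalStripCharacterWheel` put `χ̂_L = uChar` (the polynomial numerator of IP12's
character in the variables `U_k = z_k²`) into the wheel space; `DiagonalStripWheelSpace`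
(`IsWheelPoly.restrict`, `proportional_odd/even`) then gives the recursion up to a scalar. This file
computes the scalar by comparing top `U_u`-coefficients:

* `uTransfer_slice`, `uCoeff_top_uTransfer`, `uTransfer_exp_succ` — slicing the transfer
  `uTransfer` along one variable; its top coefficient; raising the exponent;
* `uCoeff_top_spS` (x-branching in coefficient form), **`uCoeff_top_uChar_odd/even`** (U-branching:
  the top `U_u`-coefficient of `χ̂_{L+1}` is `(∏ U_n)^{[L even]} χ̂_L(U_{u+1}, …)`);
* `uCoeff_uCoeff_symm`, `uCoeff_uCoeff_eq_zero_of_pair` — bivariate slices of a symmetric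
  polynomial with a pair bound;
* `coeff_top_rapUni_resEta_uChar` — the top coefficient of `Ψ(χ̂_{L+2})`, `Ψ = rapUni_u ∘ resEta`, as
  a sum over the bivariate slices `d + e = L`;
* **`resEta_uChar_odd`**: `χ̂_{2m+3}|_{U_{u+1} = ωU_u} = -ω^{2m} · χ̂_{2m+1}(U_{u+2}, …) · U_u · E`,
  **`resEta_uChar_even`**: `χ̂_{2m+4}|_{U_{u+1} = ωU_u} = ω^{2m+2} · χ̂_{2m+2}(U_{u+2}, …) · E`,
  with `E = wheelE = ∏_ℓ (U_u - ω U_ℓ)(U_ℓ U_u - ω)` — IP12's (26)–(27) with the constants made exact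
  (IP12 states (26) "up to a numerical constant").

## References

* Y. Ikhlef, A. K. Ponsaing, *Finite-size left-passage probability in percolation*, J. Stat. Phys.
  149 (2012) 10–36, arXiv:1202.5476, Def. 3.4, Prop. 3.4, (26)–(27). [IkhlefPonsaing2012]
-/

namespace Literature.Probability.Percolation

open Finset Literature.Probability.LatticeModels Literature.Probability.LatticeModels.TemperleyLieb

/-! ### Slicing the transfer along one variable -/

section Slice

open MvPolynomial Literature.Combinatorics.Enumerative

variable {K₀ : Type*} [Field K₀]

/-- `uCoeff` beyond the degree vanishes. [folklore] -/
theorem uCoeff_eq_zero_of_lt {i d : ℕ} {F : MvPolynomial ℕ K₀} (h : F.degreeOf i < d) : uCoeff K₀ i d F = 0 := by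
  classical
  rw [uCoeff]
  refine Finset.sum_eq_zero fun s hs => ?_
  exfalso
  have h1 := (Finset.mem_filter.1 hs)
  have := monomial_le_degreeOf i h1.1
  omega

/-- **Expansion along `X_i`**: `F = Σ_d X_i^d · uCoeff i d F`. [folklore] -/
theorem eq_sum_X_pow_mul_uCoeff (i : ℕ) (F : MvPolynomial ℕ K₀) {N : ℕ} (hN : F.degreeOf i < N) :
    F = ∑ d ∈ Finset.range N, X i ^ d * uCoeff K₀ i d F := by
  apply rapUni_injective (K₀ := K₀) i
  rw [map_sum]
  conv_lhs => rw [(rapUni K₀ i F).as_sum_range' N ((natDegree_rapUni_le i F).trans_lt hN)]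
  refine Finset.sum_congr rfl fun d _ => ?_
  rw [map_mul, map_pow, rapUni_X_self, rapUni_eq_C_of_degreeOf_eq_zero (degreeOf_uCoeff_self i d F), coeff_rapUni_eq,
    mul_comm, Polynomial.C_mul_X_pow_eq_monomial]

/-- `uCoeff i d` of an `X_j`-free polynomial is `X_j`-free. [folklore] -/
theorem degreeOf_uCoeff_eq_zero {i j d : ℕ} {F : MvPolynomial ℕ K₀} (h : F.degreeOf j = 0) :
    (uCoeff K₀ i d F).degreeOf j = 0 := by
  classical
  rw [uCoeff]
  apply Nat.eq_zero_of_le_zero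
  refine (degreeOf_sum_le _ _ _).trans (Finset.sup_le fun s hs => ?_)
  have hc : coeff s F ≠ 0 := mem_support_iff.1 (Finset.mem_filter.1 hs).1
  rw [degreeOf_monomial_eq _ _ hc]
  have := monomial_le_degreeOf j (Finset.mem_filter.1 hs).1
  rw [h] at this
  by_cases hij : j = i
  · subst hij; simp
  · rw [Finsupp.erase_ne hij]; omega

/-- The transfer as a sum over any finite superset of the support. [folklore] -/
theorem uTransfer_eq_sum_superset {u L a : ℕ} {p : MvPolynomial ℕ K₀} {S : Finset (ℕ →₀ ℕ)} (hS : p.support ⊆ S) :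
    uTransfer K₀ u L a p = ∑ s ∈ S, C (coeff s p) * ∏ n ∈ Finset.Ico u (u + L), ((X n ^ 2 + 1) ^ s n * X n ^ (a - s n)) := by
  rw [uTransfer]
  refine Finset.sum_subset hS fun s _ hs => ?_
  rw [notMem_support_iff.1 hs, C_0, zero_mul]

/-- **Slicing the transfer along `X_u`**: the terms with `s_u = d` make up
`(X_u² + 1)^d X_u^{a-d} · uTransfer_{u+1, L} (uCoeff u d p)`. [folklore] -/
theorem uTransfer_slice {u L a : ℕ} {p : MvPolynomial ℕ K₀} (hu' : ∀ s ∈ p.support, s u ≤ a) :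
    uTransfer K₀ u (L + 1) a p =
      ∑ d ∈ Finset.range (a + 1), ((X u ^ 2 + 1) ^ d * X u ^ (a - d)) * uTransfer K₀ (u + 1) L a (uCoeff K₀ u d p) := by
  classical
  -- group the support by `s u`
  rw [uTransfer, ← Finset.sum_fiberwise_of_maps_to (g := fun s : ℕ →₀ ℕ => s u) (t := Finset.range (a + 1))
    (fun s hs => Finset.mem_range.2 (Nat.lt_succ_of_le (hu' s hs)))]
  refine Finset.sum_congr rfl fun d _ => ?_
  have hIco : Finset.Ico u (u + (L + 1)) = insert u (Finset.Ico (u + 1) (u + 1 + L)) := by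
    ext n; simp only [Finset.mem_Ico, Finset.mem_insert]; omega
  have hu_notin : u ∉ Finset.Ico (u + 1) (u + 1 + L) := by simp
  -- the fibre over `d` ↔ the support of `uCoeff u d p`, via `s ↦ s.erase u`
  rw [uTransfer, Finset.mul_sum]
  refine Finset.sum_bij (fun s _ => s.erase u) (fun s hs => ?_) (fun s₁ hs₁ s₂ hs₂ h => ?_) (fun t ht => ?_) (fun s hs => ?_)
  · obtain ⟨hs, hsu⟩ := Finset.mem_filter.1 hs
    rw [mem_support_iff, coeff_uCoeff _ _ _ _ (Finsupp.erase_same), ← hsu, Finsupp.erase_add_single]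
    exact mem_support_iff.1 hs
  · obtain ⟨-, hs₁u⟩ := Finset.mem_filter.1 hs₁
    obtain ⟨-, hs₂u⟩ := Finset.mem_filter.1 hs₂
    rw [← Finsupp.erase_add_single u s₁, ← Finsupp.erase_add_single u s₂, h, hs₁u, hs₂u]
  · have htu : t u = 0 := by
      have := (monomial_le_degreeOf u ht).trans (degreeOf_uCoeff_self u d p).le
      omega
    refine ⟨t + Finsupp.single u d, Finset.mem_filter.2 ⟨?_, by simp [htu]⟩, ?_⟩
    · rw [mem_support_iff, ← coeff_uCoeff _ _ _ _ htu]; exact mem_support_iff.1 ht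
    · ext n
      by_cases hn : n = u
      · subst hn; simp [htu]
      · simp [Finsupp.erase_ne hn]
  · obtain ⟨hs, hsu⟩ := Finset.mem_filter.1 hs
    rw [coeff_uCoeff _ _ _ _ (Finsupp.erase_same), ← hsu, Finsupp.erase_add_single, hIco, Finset.prod_insert hu_notin, hsu]
    rw [show ∏ n ∈ Finset.Ico (u + 1) (u + 1 + L), ((X n ^ 2 + 1) ^ (s.erase u) n * X n ^ (a - (s.erase u) n) : MvPolynomial ℕ K₀)
        = ∏ n ∈ Finset.Ico (u + 1) (u + 1 + L), ((X n ^ 2 + 1) ^ s n * X n ^ (a - s n)) from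
      Finset.prod_congr rfl fun n hn => by rw [Finsupp.erase_ne (by have := (Finset.mem_Ico.1 hn).1; omega)]]
    ring

end Slice


/-! ### The top `U_u`-coefficient of `χ̂` (branching `L+1 → L`) -/

section UBranching

open MvPolynomial Literature.Combinatorics.Enumerative

variable {K₀ : Type*} [Field K₀]

/-- `uCoeff` through a product with an `X_i`-free factor. [folklore] -/
theorem uCoeff_mul_of_degreeOf_eq_zero (i d : ℕ) (f : MvPolynomial ℕ K₀) {g : MvPolynomial ℕ K₀} (hg : g.degreeOf i = 0) :
    uCoeff K₀ i d (f * g) = uCoeff K₀ i d f * g := by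
  apply toRF_injective
  rw [← coeff_rapUni_eq, map_mul, rapUni_eq_C_of_degreeOf_eq_zero hg, Polynomial.coeff_mul_C, coeff_rapUni_eq, map_mul]

/-- The one-variable factor of the transfer as a polynomial in `T`: monic of degree `a + d`. [folklore] -/
theorem rapUni_transferFactor (u a d : ℕ) (hd : d ≤ a) :
    rapUni K₀ u ((X u ^ 2 + 1) ^ d * X u ^ (a - d)) = (Polynomial.X ^ 2 + 1) ^ d * Polynomial.X ^ (a - d) ∧
      ((Polynomial.X ^ 2 + 1 : Polynomial (RapidityField K₀)) ^ d * Polynomial.X ^ (a - d)).Monic ∧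
      ((Polynomial.X ^ 2 + 1 : Polynomial (RapidityField K₀)) ^ d * Polynomial.X ^ (a - d)).natDegree = a + d := by
  have hm : ((Polynomial.X ^ 2 + 1 : Polynomial (RapidityField K₀))).Monic := Polynomial.monic_X_pow_add_C 1 two_ne_zero
  have hdeg : ((Polynomial.X ^ 2 + 1 : Polynomial (RapidityField K₀))).natDegree = 2 := by
    rw [show (1 : Polynomial (RapidityField K₀)) = Polynomial.C 1 from rfl, Polynomial.natDegree_X_pow_add_C]
  refine ⟨by rw [map_mul, map_pow, map_pow, map_add, map_pow, rapUni_X_self, map_one], (hm.pow d).mul (Polynomial.monic_X_pow _), ?_⟩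
  rw [(hm.pow d).natDegree_mul (Polynomial.monic_X_pow _), Polynomial.natDegree_pow, hdeg, Polynomial.natDegree_X_pow]
  omega

/-- Hence its top `X_u`-coefficient at `2a`: `1` for `d = a`, `0` for `d < a`. [folklore] -/
theorem uCoeff_transferFactor (u a d : ℕ) (hd : d ≤ a) :
    uCoeff K₀ u (2 * a) ((X u ^ 2 + 1) ^ d * X u ^ (a - d)) = if d = a then 1 else 0 := by
  obtain ⟨h1, h2, h3⟩ := rapUni_transferFactor (K₀ := K₀) u a d hd
  apply toRF_injective
  rw [← coeff_rapUni_eq, h1]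
  split_ifs with hda
  · subst hda
    rw [map_one, show 2 * d = d + d by ring, ← h3]
    exact h2
  · rw [map_zero]
    exact Polynomial.coeff_eq_zero_of_natDegree_lt (by rw [h3]; omega)

/-- The transfer has no variable outside its window (no hypothesis on `p`). [folklore] -/
theorem degreeOf_uTransfer_eq_zero {u L a n : ℕ} (hn : n ∉ Finset.Ico u (u + L)) (p : MvPolynomial ℕ K₀) :
    (uTransfer K₀ u L a p).degreeOf n = 0 := by
  classical
  rw [uTransfer]
  apply Nat.eq_zero_of_le_zero
  refine (degreeOf_sum_le _ _ _).trans (Finset.sup_le fun s _ => (degreeOf_C_mul_le _ _ _).trans ?_)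
  refine (degreeOf_prod_le _ _ _).trans (le_of_eq (Finset.sum_eq_zero fun k hk => ?_))
  have hkn : k ≠ n := fun h => hn (h ▸ hk)
  apply Nat.eq_zero_of_le_zero
  refine (degreeOf_mul_le _ _ _).trans ?_
  rw [degreeOf_pow_eq _ _ _ (X_ne_zero _), degreeOf_X, if_neg (Ne.symm hkn), mul_zero, add_zero]
  refine (degreeOf_pow_le _ _ _).trans ?_
  have : (X k ^ 2 + 1 : MvPolynomial ℕ K₀).degreeOf n = 0 := by
    apply Nat.eq_zero_of_le_zero
    refine (degreeOf_add_le _ _ _).trans (max_le ?_ ?_)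
    · rw [degreeOf_pow_eq _ _ _ (X_ne_zero _), degreeOf_X, if_neg (Ne.symm hkn), mul_zero]
    · rw [degreeOf_one]
  rw [this, mul_zero]

/-- `uCoeff` is additive. [folklore] -/
theorem uCoeff_add (i d : ℕ) (F G : MvPolynomial ℕ K₀) : uCoeff K₀ i d (F + G) = uCoeff K₀ i d F + uCoeff K₀ i d G := by
  apply toRF_injective
  rw [← coeff_rapUni_eq, map_add, Polynomial.coeff_add, coeff_rapUni_eq, coeff_rapUni_eq, map_add]

/-- `uCoeff` through finite sums. [folklore] -/
theorem uCoeff_finset_sum {ι : Type*} (i d : ℕ) (S : Finset ι) (f : ι → MvPolynomial ℕ K₀) :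
    uCoeff K₀ i d (∑ k ∈ S, f k) = ∑ k ∈ S, uCoeff K₀ i d (f k) := by
  classical
  induction S using Finset.induction_on with
  | empty =>
    rw [Finset.sum_empty, Finset.sum_empty]
    apply toRF_injective
    rw [← coeff_rapUni_eq, map_zero, map_zero, Polynomial.coeff_zero]
  | insert k S hk ih => rw [Finset.sum_insert hk, Finset.sum_insert hk, uCoeff_add, ih]

/-- **The top `X_u`-coefficient of the transfer** is the transfer, on the remaining window and with
the same exponent, of the top `x_u`-coefficient. [folklore] -/
theorem uCoeff_top_uTransfer {u L a : ℕ} {p : MvPolynomial ℕ K₀} (hu' : ∀ s ∈ p.support, s u ≤ a) :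
    uCoeff K₀ u (2 * a) (uTransfer K₀ u (L + 1) a p) = uTransfer K₀ (u + 1) L a (uCoeff K₀ u a p) := by
  classical
  rw [uTransfer_slice hu', uCoeff_finset_sum]
  have hfree : ∀ d, (uTransfer K₀ (u + 1) L a (uCoeff K₀ u d p)).degreeOf u = 0 := fun d =>
    degreeOf_uTransfer_eq_zero (by simp) _
  rw [Finset.sum_congr rfl fun d hd => by
    rw [uCoeff_mul_of_degreeOf_eq_zero _ _ _ (hfree d),
      uCoeff_transferFactor u a d (Nat.lt_succ_iff.1 (Finset.mem_range.1 hd))]]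
  simp only [ite_mul, one_mul, zero_mul, Finset.sum_ite_eq', Finset.mem_range]
  rw [if_pos (by omega)]

/-- **Raising the exponent of the transfer by one** multiplies by the product of the window variables
(when the degrees allow it). [folklore] -/
theorem uTransfer_exp_succ {u L a : ℕ} {p : MvPolynomial ℕ K₀} (h : ∀ s ∈ p.support, ∀ n ∈ Finset.Ico u (u + L), s n ≤ a) :
    uTransfer K₀ u L (a + 1) p = (∏ n ∈ Finset.Ico u (u + L), X n) * uTransfer K₀ u L a p := by
  rw [uTransfer, uTransfer, Finset.mul_sum]
  refine Finset.sum_congr rfl fun s hs => ?_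
  rw [mul_left_comm, ← Finset.prod_mul_distrib]
  congr 1
  refine Finset.prod_congr rfl fun n hn => ?_
  rw [show a + 1 - s n = (a - s n) + 1 by have := h s hs n hn; omega, pow_succ]
  ring

/-- **The x-branching in coefficient form**: the top `x_u`-coefficient of `S_{L+1}` is `S_L` on the next
window. [cite: IkhlefPonsaing2012, Def. 3.4] -/
theorem uCoeff_top_spS [CharZero K₀] (u L : ℕ) : uCoeff K₀ u (L / 2) (spS K₀ u (L + 1)) = spS K₀ (u + 1) L := by
  obtain ⟨hdeg, hlc⟩ := natDegree_leadingCoeff_rapUni_spS (K₀ := K₀) u L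
  have hd : ipMu L - 1 - L = L / 2 := by unfold ipMu; omega
  apply toRF_injective
  rw [← coeff_rapUni_eq, ← hlc, Polynomial.leadingCoeff, hdeg, hd]

/-- The unfolding of `uChar` with the exponent computed. [folklore] -/
theorem uChar_eq (u L a : ℕ) (ha : (L - 1) / 2 = a) : uChar K₀ u L = uTransfer K₀ u L a (spS K₀ u L) := by
  rw [uChar, ha]

/-- Support exponents of `S_L` are at most `⌊(L-1)/2⌋`. [folklore] -/
theorem supp_spS_le [CharZero K₀] (u L : ℕ) {s : ℕ →₀ ℕ} (hs : s ∈ (spS K₀ u L).support) (n : ℕ) : s n ≤ (L - 1) / 2 :=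
  (monomial_le_degreeOf n hs).trans (degreeOf_spS_le u L n)

/-- **U-branching, odd window**: the top `U_u`-coefficient of `χ̂_{2m+3}` is
`(∏_{n > u} U_n) · χ̂_{2m+2}(U_{u+1}, …)`. [cite: IkhlefPonsaing2012, Prop. 3.4, (26)] -/
theorem uCoeff_top_uChar_odd [CharZero K₀] (u m : ℕ) :
    uCoeff K₀ u (2 * (m + 1)) (uChar K₀ u (2 * m + 3)) =
      (∏ n ∈ Finset.Ico (u + 1) (u + 1 + (2 * m + 2)), X n) * uChar K₀ (u + 1) (2 * m + 2) := by
  have hb := uCoeff_top_spS (K₀ := K₀) u (2 * m + 2)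
  rw [show (2 * m + 2) / 2 = m + 1 by omega] at hb
  rw [uChar_eq u (2 * m + 3) (m + 1) (by omega), show 2 * m + 3 = (2 * m + 2) + 1 by ring,
    uCoeff_top_uTransfer (fun s hs => (supp_spS_le u _ hs u).trans (by omega)), hb,
    uChar_eq (u + 1) (2 * m + 2) m (by omega), uTransfer_exp_succ]
  intro s hs n _
  exact (supp_spS_le (u + 1) _ hs n).trans (by omega)

/-- **U-branching, even window**: the top `U_u`-coefficient of `χ̂_{2m+2}` is `χ̂_{2m+1}(U_{u+1}, …)`.
[cite: IkhlefPonsaing2012, Prop. 3.4, (26)] -/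
theorem uCoeff_top_uChar_even [CharZero K₀] (u m : ℕ) :
    uCoeff K₀ u (2 * m) (uChar K₀ u (2 * m + 2)) = uChar K₀ (u + 1) (2 * m + 1) := by
  have hb := uCoeff_top_spS (K₀ := K₀) u (2 * m + 1)
  rw [show (2 * m + 1) / 2 = m by omega] at hb
  rw [uChar_eq u (2 * m + 2) m (by omega), show 2 * m + 2 = (2 * m + 1) + 1 by ring,
    uCoeff_top_uTransfer (fun s hs => (supp_spS_le u _ hs u).trans (by omega)), hb,
    uChar_eq (u + 1) (2 * m + 1) m (by omega)]

end UBranching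

/-! ### Bivariate coefficients: symmetry and the pair bound -/

section Bivariate

open MvPolynomial

variable {K₀ : Type*} [Field K₀]

/-- A coefficient involving an absent variable vanishes. [folklore] -/
theorem coeff_eq_zero_of_degreeOf_eq_zero {H : MvPolynomial ℕ K₀} {j : ℕ} (h : H.degreeOf j = 0) {t : ℕ →₀ ℕ} (ht : t j ≠ 0) :
    coeff t H = 0 := by
  by_contra hc
  have := monomial_le_degreeOf j (mem_support_iff.2 hc)
  omega

/-- The coefficients of the bivariate slice `uCoeff (u+1) e (uCoeff u d F)`. [folklore] -/
theorem coeff_uCoeff_uCoeff (u d e : ℕ) (F : MvPolynomial ℕ K₀) (t : ℕ →₀ ℕ) (htu : t u = 0) (htu1 : t (u + 1) = 0) :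
    coeff t (uCoeff K₀ (u + 1) e (uCoeff K₀ u d F)) = coeff (t + Finsupp.single (u + 1) e + Finsupp.single u d) F := by
  rw [coeff_uCoeff _ _ _ _ htu1, coeff_uCoeff _ _ _ _ (by simp [htu])]

/-- The bivariate slice is free of `X_u` and `X_{u+1}`. [folklore] -/
theorem degreeOf_uCoeff_uCoeff (u d e : ℕ) (F : MvPolynomial ℕ K₀) :
    (uCoeff K₀ (u + 1) e (uCoeff K₀ u d F)).degreeOf u = 0 ∧ (uCoeff K₀ (u + 1) e (uCoeff K₀ u d F)).degreeOf (u + 1) = 0 :=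
  ⟨degreeOf_uCoeff_eq_zero (degreeOf_uCoeff_self u d F), degreeOf_uCoeff_self _ _ _⟩

/-- **Symmetry of the bivariate slices** of a polynomial symmetric under `X_u ↔ X_{u+1}`. [folklore] -/
theorem uCoeff_uCoeff_symm {u : ℕ} {F : MvPolynomial ℕ K₀} (hF : rename (Equiv.swap u (u + 1)) F = F) (d e : ℕ) :
    uCoeff K₀ (u + 1) e (uCoeff K₀ u d F) = uCoeff K₀ (u + 1) d (uCoeff K₀ u e F) := by
  classical
  ext t
  by_cases ht : t u = 0 ∧ t (u + 1) = 0
  · rw [coeff_uCoeff_uCoeff _ _ _ _ _ ht.1 ht.2, coeff_uCoeff_uCoeff _ _ _ _ _ ht.1 ht.2]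
    have hinj := Equiv.injective (Equiv.swap u (u + 1))
    conv_lhs => rw [← hF]
    have ht' : Finsupp.mapDomain (Equiv.swap u (u + 1)) t = t := by
      ext n
      rw [Finsupp.mapDomain_equiv_apply, Equiv.symm_swap]
      rcases eq_or_ne n u with rfl | hnu
      · rw [Equiv.swap_apply_left, ht.1, ht.2]
      · rcases eq_or_ne n (u + 1) with rfl | hnu1
        · rw [Equiv.swap_apply_right, ht.1, ht.2]
        · rw [Equiv.swap_apply_of_ne_of_ne hnu hnu1]
    have : t + Finsupp.single (u + 1) e + Finsupp.single u d =
        Finsupp.mapDomain (Equiv.swap u (u + 1)) (t + Finsupp.single (u + 1) d + Finsupp.single u e) := by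
      rw [Finsupp.mapDomain_add, Finsupp.mapDomain_add, Finsupp.mapDomain_single, Finsupp.mapDomain_single, ht',
        Equiv.swap_apply_right, Equiv.swap_apply_left]
      abel
    rw [this, coeff_rename_mapDomain _ hinj]
  · obtain ⟨h1, h2⟩ := degreeOf_uCoeff_uCoeff (K₀ := K₀) u d e F
    obtain ⟨h1', h2'⟩ := degreeOf_uCoeff_uCoeff (K₀ := K₀) u e d F
    rcases not_and_or.1 ht with h | h
    · rw [coeff_eq_zero_of_degreeOf_eq_zero h1 h, coeff_eq_zero_of_degreeOf_eq_zero h1' h]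
    · rw [coeff_eq_zero_of_degreeOf_eq_zero h2 h, coeff_eq_zero_of_degreeOf_eq_zero h2' h]

/-- **Bivariate slices beyond the pair bound vanish.** [folklore] -/
theorem uCoeff_uCoeff_eq_zero_of_pair {u B d e : ℕ} {F : MvPolynomial ℕ K₀} (hpair : ∀ s ∈ F.support, s u + s (u + 1) ≤ B)
    (hde : B < d + e) : uCoeff K₀ (u + 1) e (uCoeff K₀ u d F) = 0 := by
  classical
  ext t
  rw [coeff_zero]
  by_cases ht : t u = 0 ∧ t (u + 1) = 0
  · rw [coeff_uCoeff_uCoeff _ _ _ _ _ ht.1 ht.2]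
    by_contra hc
    have := hpair _ (mem_support_iff.2 hc)
    simp only [Finsupp.coe_add, Pi.add_apply, Finsupp.single_apply, ht.1, ht.2] at this
    simp at this
    omega
  · obtain ⟨h1, h2⟩ := degreeOf_uCoeff_uCoeff (K₀ := K₀) u d e F
    rcases not_and_or.1 ht with h | h
    · exact coeff_eq_zero_of_degreeOf_eq_zero h1 h
    · exact coeff_eq_zero_of_degreeOf_eq_zero h2 h

/-- The support exponents of `uCoeff u d F` at another variable are support exponents of `F`. [folklore] -/
theorem supp_uCoeff_le {u d j a : ℕ} {F : MvPolynomial ℕ K₀} (h : ∀ s ∈ F.support, s j ≤ a) (hju : j ≠ u)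
    {t : ℕ →₀ ℕ} (ht : t ∈ (uCoeff K₀ u d F).support) : t j ≤ a := by
  have htu : t u = 0 := by
    have := (monomial_le_degreeOf u ht).trans (degreeOf_uCoeff_self u d F).le; omega
  have h1 : coeff (t + Finsupp.single u d) F ≠ 0 := by rw [← coeff_uCoeff _ _ _ _ htu]; exact mem_support_iff.1 ht
  have := h _ (mem_support_iff.2 h1)
  simp only [Finsupp.coe_add, Pi.add_apply, Finsupp.single_apply, if_neg (Ne.symm hju), add_zero] at this
  exact this

end Bivariate

/-! ### The restriction of `χ̂` to `U_{u+1} = ω U_u`: exact constants -/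

section Recursion

open MvPolynomial Literature.Combinatorics.Enumerative

variable {K₀ : Type*} [Field K₀]

/-- A substitution for an absent variable does nothing. [folklore] -/
theorem substHom_eq_self_of_degreeOf_eq_zero (k : ℕ) (g : MvPolynomial ℕ K₀) {F : MvPolynomial ℕ K₀} (h : F.degreeOf k = 0) :
    substHom k g F = F := by
  have := MvPolynomial.hom_congr_vars (f₁ := (substHom k g).toRingHom) (f₂ := RingHom.id _) (p₁ := F) (p₂ := F)
    (by ext a; simp) (fun i hi _ => ?_) rfl
  · simpa using this
  · have hik : i ≠ k := by
      rintro rfl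
      obtain ⟨d, hd, hid⟩ := (MvPolynomial.mem_vars_iff_mem_support i).1 hi
      have := monomial_le_degreeOf i hd
      rw [h] at this
      exact (Finsupp.mem_support_iff.1 hid) (by omega)
    simp [substHom_X_of_ne g hik]

/-- `Ψ = rapUni_u ∘ resEta` on a polynomial free of `X_u, X_{u+1}`: a constant. [folklore] -/
theorem rapUni_resEta_of_free (ω : K₀) (u : ℕ) {g : MvPolynomial ℕ K₀} (hu : g.degreeOf u = 0) (hu1 : g.degreeOf (u + 1) = 0) :
    rapUni K₀ u (resEta K₀ ω u g) = Polynomial.C (toRF K₀ g) := by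
  rw [resEta, substHom_eq_self_of_degreeOf_eq_zero _ _ hu1, rapUni_eq_C_of_degreeOf_eq_zero hu]

/-- `Ψ` on the `X_u`-factor of the transfer. [folklore] -/
theorem rapUni_resEta_factor_self (ω : K₀) (u a d : ℕ) :
    rapUni K₀ u (resEta K₀ ω u ((X u ^ 2 + 1) ^ d * X u ^ (a - d))) =
      (Polynomial.X ^ 2 + 1) ^ d * Polynomial.X ^ (a - d) := by
  have hfree : ((X u ^ 2 + 1) ^ d * X u ^ (a - d) : MvPolynomial ℕ K₀).degreeOf (u + 1) = 0 := by
    apply Nat.eq_zero_of_le_zero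
    refine (degreeOf_mul_le _ _ _).trans ?_
    rw [degreeOf_pow_eq _ _ _ (X_ne_zero _), degreeOf_X, if_neg (by omega), mul_zero, add_zero]
    refine (degreeOf_pow_le _ _ _).trans ?_
    have : (X u ^ 2 + 1 : MvPolynomial ℕ K₀).degreeOf (u + 1) = 0 := by
      apply Nat.eq_zero_of_le_zero
      refine (degreeOf_add_le _ _ _).trans (max_le ?_ (by rw [degreeOf_one]))
      rw [degreeOf_pow_eq _ _ _ (X_ne_zero _), degreeOf_X, if_neg (by omega), mul_zero]
    rw [this, mul_zero]
  rw [resEta, substHom_eq_self_of_degreeOf_eq_zero _ _ hfree, map_mul, map_pow, map_pow, map_add, map_pow, rapUni_X_self,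
    map_one]

/-- `Ψ` on the `X_{u+1}`-factor of the transfer. [folklore] -/
theorem rapUni_resEta_factor_succ (ω : K₀) (u a e : ℕ) :
    rapUni K₀ u (resEta K₀ ω u ((X (u + 1) ^ 2 + 1) ^ e * X (u + 1) ^ (a - e))) =
      ((Polynomial.C (genC K₀ ω) * Polynomial.X) ^ 2 + 1) ^ e * (Polynomial.C (genC K₀ ω) * Polynomial.X) ^ (a - e) := by
  have h1 : rapUni K₀ u (resEta K₀ ω u (X (u + 1))) = Polynomial.C (genC K₀ ω) * Polynomial.X := by
    rw [resEta_X, if_pos rfl, map_mul, rapUni_C, rapUni_X_self]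
  rw [map_mul, map_pow, map_pow, map_add, map_pow, map_one, map_mul, map_pow, map_pow, map_add, map_pow, map_one, h1]

/-- Degree and top coefficient of the `X_u`-factor. [folklore] -/
theorem natDegree_coeff_factor_self (a d : ℕ) :
    ((Polynomial.X ^ 2 + 1 : Polynomial (RapidityField K₀)) ^ d * Polynomial.X ^ (a - d)).natDegree ≤ 2 * d + (a - d) ∧
      ((Polynomial.X ^ 2 + 1 : Polynomial (RapidityField K₀)) ^ d * Polynomial.X ^ (a - d)).coeff (2 * d + (a - d)) = 1 := by
  have hm : ((Polynomial.X ^ 2 + 1 : Polynomial (RapidityField K₀))).Monic := Polynomial.monic_X_pow_add_C 1 two_ne_zero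
  have hdeg : ((Polynomial.X ^ 2 + 1 : Polynomial (RapidityField K₀))).natDegree = 2 := by
    rw [show (1 : Polynomial (RapidityField K₀)) = Polynomial.C 1 from rfl, Polynomial.natDegree_X_pow_add_C]
  have hmon := (hm.pow d).mul (Polynomial.monic_X_pow (R := RapidityField K₀) (a - d))
  have hnd : ((Polynomial.X ^ 2 + 1 : Polynomial (RapidityField K₀)) ^ d * Polynomial.X ^ (a - d)).natDegree = 2 * d + (a - d) := by
    rw [(hm.pow d).natDegree_mul (Polynomial.monic_X_pow _), Polynomial.natDegree_pow, hdeg, Polynomial.natDegree_X_pow]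
    ring
  refine ⟨hnd.le, ?_⟩
  rw [← hnd]
  exact hmon

/-- Degree and top coefficient of the `X_{u+1}`-factor: `ω^{a+e}` at degree `a + e`. [folklore] -/
theorem natDegree_coeff_factor_succ (ω : K₀) (a e : ℕ) (he : e ≤ a) :
    (((Polynomial.C (genC K₀ ω) * Polynomial.X) ^ 2 + 1) ^ e *
        (Polynomial.C (genC K₀ ω) * Polynomial.X) ^ (a - e) : Polynomial (RapidityField K₀)).natDegree ≤ a + e ∧
      (((Polynomial.C (genC K₀ ω) * Polynomial.X) ^ 2 + 1) ^ e *
        (Polynomial.C (genC K₀ ω) * Polynomial.X) ^ (a - e) : Polynomial (RapidityField K₀)).coeff (a + e) =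
        genC K₀ ω ^ (a + e) := by
  set c := genC K₀ ω with hc
  have hp : ((Polynomial.C c * Polynomial.X) ^ 2 + 1 : Polynomial (RapidityField K₀)) =
      Polynomial.C (c ^ 2) * Polynomial.X ^ 2 + 1 := by
    rw [mul_pow, map_pow]
  have hq : ((Polynomial.C c * Polynomial.X) ^ (a - e) : Polynomial (RapidityField K₀)) =
      Polynomial.C (c ^ (a - e)) * Polynomial.X ^ (a - e) := by
    rw [mul_pow, map_pow]
  have hdeg1 : (Polynomial.C (c ^ 2) * Polynomial.X ^ 2 + 1 : Polynomial (RapidityField K₀)).natDegree ≤ 2 := by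
    refine (Polynomial.natDegree_add_le _ _).trans (max_le (Polynomial.natDegree_C_mul_X_pow_le _ _) ?_)
    rw [Polynomial.natDegree_one]; exact Nat.zero_le _
  have hdegp : ((Polynomial.C (c ^ 2) * Polynomial.X ^ 2 + 1 : Polynomial (RapidityField K₀)) ^ e).natDegree ≤ 2 * e := by
    refine Polynomial.natDegree_pow_le.trans ?_
    calc e * (Polynomial.C (c ^ 2) * Polynomial.X ^ 2 + 1 : Polynomial (RapidityField K₀)).natDegree ≤ e * 2 :=
          Nat.mul_le_mul_left _ hdeg1
      _ = 2 * e := by ring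
  have hdegq : (Polynomial.C (c ^ (a - e)) * Polynomial.X ^ (a - e) : Polynomial (RapidityField K₀)).natDegree ≤ a - e :=
    Polynomial.natDegree_C_mul_X_pow_le _ _
  rw [hp, hq]
  refine ⟨(Polynomial.natDegree_mul_le.trans (Nat.add_le_add hdegp hdegq)).trans (by omega), ?_⟩
  rw [show a + e = 2 * e + (a - e) by omega, Polynomial.coeff_mul_add_eq_of_natDegree_le hdegp hdegq,
    show 2 * e = e * 2 by ring, Polynomial.coeff_pow_of_natDegree_le hdeg1, Polynomial.coeff_add, Polynomial.coeff_C_mul,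
    Polynomial.coeff_X_pow, if_pos rfl, mul_one, Polynomial.coeff_one, if_neg (by norm_num), add_zero,
    Polynomial.coeff_C_mul, Polynomial.coeff_X_pow, if_pos rfl, mul_one, ← pow_mul, ← pow_add]
  congr 1; omega

/-- The transfer of `0` is `0`. [folklore] -/
theorem uTransfer_zero (u L a : ℕ) : uTransfer K₀ u L a (0 : MvPolynomial ℕ K₀) = 0 := by
  rw [uTransfer, support_zero, Finset.sum_empty]

/-- **The top `T`-coefficient of `Ψ(χ̂_{L+2})`, `Ψ = rapUni_u ∘ resEta`**, as a sum over the bivariate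
slices `(d, e)` of `S_{L+2}` with `d + e = L` (the `x`-pair bound). [cite: IkhlefPonsaing2012, Prop. 3.4, (26)] -/
theorem coeff_top_rapUni_resEta_uChar [CharZero K₀] (ω : K₀) (u L a : ℕ) (ha : (L + 1) / 2 = a) :
    (rapUni K₀ u (resEta K₀ ω u (uChar K₀ u (L + 2)))).coeff (2 * a + L) =
      ∑ d ∈ Finset.range (a + 1), ∑ e ∈ Finset.range (a + 1),
        if d + e = L then genC K₀ ω ^ (a + e) *
          toRF K₀ (uTransfer K₀ (u + 2) L a (uCoeff K₀ (u + 1) e (uCoeff K₀ u d (spS K₀ u (L + 2))))) else 0 := by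
  classical
  set S := spS K₀ u (L + 2) with hS
  have hsupp : ∀ s ∈ S.support, ∀ n, s n ≤ a := fun s hs n => (supp_spS_le u _ hs n).trans (by omega)
  have hpairS : ∀ s ∈ S.support, s u + s (u + 1) ≤ L := pairDeg_le_iff.1 (pairDeg_spS_le u L)
  -- double slicing
  have hslice : uChar K₀ u (L + 2) = ∑ d ∈ Finset.range (a + 1), (X u ^ 2 + 1) ^ d * X u ^ (a - d) *
      ∑ e ∈ Finset.range (a + 1), (X (u + 1) ^ 2 + 1) ^ e * X (u + 1) ^ (a - e) *
        uTransfer K₀ (u + 2) L a (uCoeff K₀ (u + 1) e (uCoeff K₀ u d S)) := by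
    rw [uChar_eq u (L + 2) a (by omega), show L + 2 = (L + 1) + 1 by ring, uTransfer_slice (fun s hs => hsupp s hs u)]
    refine Finset.sum_congr rfl fun d _ => ?_
    rw [uTransfer_slice (fun t ht => supp_uCoeff_le (fun s hs => hsupp s hs (u + 1)) (by omega) ht),
      show u + 1 + 1 = u + 2 by ring]
  rw [hslice, map_sum, map_sum, Polynomial.finsetSum_coeff]
  refine Finset.sum_congr rfl fun d hd => ?_
  rw [map_mul, map_mul, rapUni_resEta_factor_self, map_sum, map_sum, Finset.mul_sum, Polynomial.finsetSum_coeff]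
  refine Finset.sum_congr rfl fun e he => ?_
  have hda : d ≤ a := Nat.lt_succ_iff.1 (Finset.mem_range.1 hd)
  have hea : e ≤ a := Nat.lt_succ_iff.1 (Finset.mem_range.1 he)
  obtain ⟨hfu, hfu1⟩ := degreeOf_uCoeff_uCoeff (K₀ := K₀) u d e S
  set r := uTransfer K₀ (u + 2) L a (uCoeff K₀ (u + 1) e (uCoeff K₀ u d S)) with hr
  have hru : r.degreeOf u = 0 := degreeOf_uTransfer_eq_zero (by simp) _
  have hru1 : r.degreeOf (u + 1) = 0 := degreeOf_uTransfer_eq_zero (by simp) _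
  rw [map_mul, map_mul, rapUni_resEta_factor_succ, rapUni_resEta_of_free ω u hru hru1]
  obtain ⟨hA1, hA2⟩ := natDegree_coeff_factor_self (K₀ := K₀) a d
  obtain ⟨hB1, hB2⟩ := natDegree_coeff_factor_succ (K₀ := K₀) ω a e hea
  have hBC : (((Polynomial.C (genC K₀ ω) * Polynomial.X) ^ 2 + 1) ^ e * (Polynomial.C (genC K₀ ω) * Polynomial.X) ^ (a - e) *
      Polynomial.C (toRF K₀ r)).natDegree ≤ a + e :=
    Polynomial.natDegree_mul_le.trans (by rw [Polynomial.natDegree_C, add_zero]; exact hB1)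
  rcases Nat.lt_trichotomy (d + e) L with hlt | heq | hgt
  · rw [if_neg hlt.ne]
    apply Polynomial.coeff_eq_zero_of_natDegree_lt
    refine (Polynomial.natDegree_mul_le.trans (Nat.add_le_add hA1 hBC)).trans_lt (by omega)
  · rw [if_pos heq, show 2 * a + L = (2 * d + (a - d)) + (a + e) by omega, Polynomial.coeff_mul_add_eq_of_natDegree_le hA1 hBC,
      hA2, one_mul, Polynomial.coeff_mul_C, hB2]
  · rw [if_neg (by omega), hr, uCoeff_uCoeff_eq_zero_of_pair hpairS hgt, uTransfer_zero, map_zero, map_zero, mul_zero,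
      mul_zero, Polynomial.coeff_zero]

/-- The top coefficient of `rapUni_u (wheelE)`: the product of the `z_ℓ`. [folklore] -/
theorem coeff_top_rapUni_wheelE (ω : K₀) (u L : ℕ) :
    (rapUni K₀ u (wheelE K₀ ω u L)).coeff (2 * L) = ∏ ℓ ∈ Finset.Ico (u + 2) (u + 2 + L), genZ K₀ ℓ := by
  rw [rapUni_wheelE, Polynomial.coeff_C_mul]
  have hmon : ∀ ℓ ∈ Finset.Ico (u + 2) (u + 2 + L),
      ((Polynomial.X - Polynomial.C (genC K₀ ω * genZ K₀ ℓ)) * (Polynomial.X - Polynomial.C (genC K₀ ω * (genZ K₀ ℓ)⁻¹))).Monic ∧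
      ((Polynomial.X - Polynomial.C (genC K₀ ω * genZ K₀ ℓ)) * (Polynomial.X - Polynomial.C (genC K₀ ω * (genZ K₀ ℓ)⁻¹))).natDegree
        = 2 := fun ℓ _ =>
    ⟨(Polynomial.monic_X_sub_C _).mul (Polynomial.monic_X_sub_C _), by
      rw [(Polynomial.monic_X_sub_C _).natDegree_mul (Polynomial.monic_X_sub_C _), Polynomial.natDegree_X_sub_C,
        Polynomial.natDegree_X_sub_C]⟩
  have hM := Polynomial.monic_prod_of_monic _ _ fun ℓ hℓ => (hmon ℓ hℓ).1
  have hdeg : (∏ ℓ ∈ Finset.Ico (u + 2) (u + 2 + L), ((Polynomial.X - Polynomial.C (genC K₀ ω * genZ K₀ ℓ)) *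
      (Polynomial.X - Polynomial.C (genC K₀ ω * (genZ K₀ ℓ)⁻¹)))).natDegree = 2 * L := by
    rw [Polynomial.natDegree_prod_of_monic _ _ fun ℓ hℓ => (hmon ℓ hℓ).1,
      Finset.sum_congr rfl fun ℓ hℓ => (hmon ℓ hℓ).2, Finset.sum_const, Nat.card_Ico, smul_eq_mul]
    omega
  rw [← hdeg, hM.coeff_natDegree, mul_one]

/-- `genC` is injective. [folklore] -/
theorem genC_injective' : Function.Injective (genC K₀) := fun _ _ h =>
  C_injective ℕ K₀ (toRF_injective (K₀ := K₀) h)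

/-- The common value of the two top bivariate slices of `S_{L+2}`: the transfer with exponent `a`
of `S_L` on the window `[u+2, u+2+L)` is `(∏ U_n) · χ̂_L`. [folklore] -/
theorem uTransfer_spS_succ_exp [CharZero K₀] (u L a : ℕ) (ha : (L - 1) / 2 + 1 = a) :
    uTransfer K₀ (u + 2) L a (spS K₀ (u + 2) L) = (∏ n ∈ Finset.Ico (u + 2) (u + 2 + L), X n) * uChar K₀ (u + 2) L := by
  rw [← ha, uTransfer_exp_succ (fun s hs n _ => supp_spS_le (u + 2) L hs n), uChar]

/-- **IP12 (26), odd window, exact constant**: `χ̂_{2m+3}|_{U_{u+1} = ω U_u} =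
-ω^{2m} · U_u · E · χ̂_{2m+1}(U_{u+2}, …)`. [cite: IkhlefPonsaing2012, Prop. 3.4, (26)–(27)] -/
theorem resEta_uChar_odd [CharZero K₀] [Algebra ℝ K₀] {ω : K₀} (hω : ω ^ 2 + ω + 1 = 0) (hω1 : ω ≠ 1) (u m : ℕ) :
    resEta K₀ ω u (uChar K₀ u (2 * m + 3)) =
      C (-ω ^ (2 * m)) * uChar K₀ (u + 2) (2 * m + 1) * (X u * wheelE K₀ ω u (2 * m + 1)) := by
  classical
  have hω3 : ω ^ 3 = 1 := by linear_combination (ω - 1) * hω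
  -- the wheel-space structure of the restriction
  have h := uChar_isWheelPoly_odd (K₀ := K₀) hω hω1 u (m + 1)
  rw [show 2 * (m + 1) + 1 = (2 * m + 1) + 2 by ring, show 4 * (m + 1) - 1 = 4 * m + 3 by omega] at h
  obtain ⟨c', hc', hres⟩ := h.restrict hω (by omega)
  rw [show 2 * (m + 1) - 2 = 2 * m by omega, show 4 * m + 3 - 4 = 4 * m - 1 by omega,
    show 2 * (2 * (m + 1)) - (4 * m + 3) = 1 by omega, pow_one] at *
  obtain ⟨γ, hγ⟩ := IsWheelPoly.proportional_odd hω hω1 m (u + 2) hc' (uChar_isWheelPoly_odd hω hω1 (u + 2) m)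
    (uChar_ne_zero _ _)
  rw [show (2 * m + 1) + 2 = 2 * m + 3 by ring] at hres
  -- compare top coefficients of `Ψ` on both sides
  have htop := coeff_top_rapUni_resEta_uChar (K₀ := K₀) ω u (2 * m + 1) (m + 1) (by omega)
  rw [show 2 * m + 1 + 2 = 2 * m + 3 by ring] at htop
  -- evaluate the double sum: the slices `(m, m+1)` and `(m+1, m)`
  set S := spS K₀ u (2 * m + 3) with hS
  have hsym : rename (Equiv.swap u (u + 1)) S = S := rename_swap_spS' u _ le_rfl (by omega) (by omega) (by omega)
  have hslice : uCoeff K₀ (u + 1) m (uCoeff K₀ u (m + 1) S) = spS K₀ (u + 2) (2 * m + 1) := by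
    have h1 := uCoeff_top_spS (K₀ := K₀) u (2 * m + 2)
    rw [show (2 * m + 2) / 2 = m + 1 by omega, show 2 * m + 2 + 1 = 2 * m + 3 by ring] at h1
    have h2 := uCoeff_top_spS (K₀ := K₀) (u + 1) (2 * m + 1)
    rw [show (2 * m + 1) / 2 = m by omega, show 2 * m + 1 + 1 = 2 * m + 2 by ring, show u + 1 + 1 = u + 2 by ring] at h2
    rw [h1, h2]
  have hslice' : uCoeff K₀ (u + 1) (m + 1) (uCoeff K₀ u m S) = spS K₀ (u + 2) (2 * m + 1) := by
    rw [uCoeff_uCoeff_symm hsym, hslice]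
  have hr := uTransfer_spS_succ_exp (K₀ := K₀) u (2 * m + 1) (m + 1) (by omega)
  have hsum : (∑ d ∈ Finset.range (m + 1 + 1), ∑ e ∈ Finset.range (m + 1 + 1),
      if d + e = 2 * m + 1 then genC K₀ ω ^ (m + 1 + e) *
        toRF K₀ (uTransfer K₀ (u + 2) (2 * m + 1) (m + 1) (uCoeff K₀ (u + 1) e (uCoeff K₀ u d S))) else 0) =
      genC K₀ (-ω ^ (2 * m)) * ((∏ n ∈ Finset.Ico (u + 2) (u + 2 + (2 * m + 1)), genZ K₀ n) *
        toRF K₀ (uChar K₀ (u + 2) (2 * m + 1))) := by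
    rw [Finset.sum_eq_add_of_mem m (m + 1) (by simp) (by simp) (by omega) fun d hd hdm =>
      Finset.sum_eq_zero fun e he => if_neg (by
        have := Finset.mem_range.1 hd; have := Finset.mem_range.1 he; omega)]
    rw [Finset.sum_eq_single_of_mem (m + 1) (by simp) fun e he hne => if_neg (by omega),
      Finset.sum_eq_single_of_mem m (by simp) fun e he hne => if_neg (by omega), if_pos (by ring), if_pos (by ring),
      hslice', hslice, hr, map_mul, map_prod]
    simp only [show ∀ n, toRF K₀ (X n) = genZ K₀ n from fun n => rfl]
    rw [← add_mul, show m + 1 + (m + 1) = (2 * m + 1) + 1 by ring, show m + 1 + m = 2 * m + 1 by ring]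
    congr 1
    have hg : genC K₀ ω ^ 2 + genC K₀ ω + 1 = 0 := by
      have := congrArg (fun x => toRF K₀ (C x)) hω
      simp only [map_add, map_pow, map_one, map_zero] at this
      exact this
    rw [show genC K₀ (-ω ^ (2 * m)) = -(genC K₀ ω) ^ (2 * m) by
      show toRF K₀ (C _) = -(toRF K₀ (C ω)) ^ (2 * m); rw [map_neg, map_pow, map_neg, map_pow]]
    linear_combination genC K₀ ω ^ (2 * m) * hg
  rw [hsum] at htop
  -- the same coefficient from the factorised form
  have hfree : (C γ * uChar K₀ (u + 2) (2 * m + 1)).degreeOf u = 0 := by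
    apply Nat.eq_zero_of_le_zero
    refine (degreeOf_C_mul_le _ _ _).trans ?_
    have := degreeOf_uChar_le (K₀ := K₀) (u + 2) (2 * m + 1) u
    rw [if_neg (by simp)] at this
    exact this
  have htop' : (rapUni K₀ u (resEta K₀ ω u (uChar K₀ u (2 * m + 3)))).coeff (2 * (m + 1) + (2 * m + 1)) =
      genC K₀ γ * toRF K₀ (uChar K₀ (u + 2) (2 * m + 1)) * ∏ n ∈ Finset.Ico (u + 2) (u + 2 + (2 * m + 1)), genZ K₀ n := by
    rw [hres, hγ, map_mul (rapUni K₀ u), rapUni_eq_C_of_degreeOf_eq_zero hfree, map_mul (rapUni K₀ u), rapUni_X_self,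
      Polynomial.coeff_C_mul, show 2 * (m + 1) + (2 * m + 1) = 2 * (2 * m + 1) + 1 by ring, Polynomial.coeff_X_mul,
      coeff_top_rapUni_wheelE, map_mul]
    rfl
  rw [htop'] at htop
  -- cancel the nonzero common factor
  have hne : toRF K₀ (uChar K₀ (u + 2) (2 * m + 1)) * ∏ n ∈ Finset.Ico (u + 2) (u + 2 + (2 * m + 1)), genZ K₀ n ≠ 0 :=
    mul_ne_zero (fun h0 => uChar_ne_zero (K₀ := K₀) (u + 2) (2 * m + 1) (toRF_injective (h0.trans (map_zero _).symm)))
      (Finset.prod_ne_zero_iff.2 fun n _ => genZ_ne_zero n)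
  have hγeq : genC K₀ γ = genC K₀ (-ω ^ (2 * m)) := by
    apply mul_right_cancel₀ hne
    rw [← mul_assoc, htop]; ring
  rw [hres, hγ, genC_injective' hγeq]

/-- **IP12 (26), even window, exact constant**: `χ̂_{2m+4}|_{U_{u+1} = ω U_u} =
ω^{2m+2} · E · χ̂_{2m+2}(U_{u+2}, …)`. [cite: IkhlefPonsaing2012, Prop. 3.4, (26)–(27)] -/
theorem resEta_uChar_even [CharZero K₀] [Algebra ℝ K₀] {ω : K₀} (hω : ω ^ 2 + ω + 1 = 0) (hω1 : ω ≠ 1) (u m : ℕ) :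
    resEta K₀ ω u (uChar K₀ u (2 * m + 4)) =
      C (ω ^ (2 * m + 2)) * uChar K₀ (u + 2) (2 * m + 2) * wheelE K₀ ω u (2 * m + 2) := by
  classical
  -- the wheel-space structure of the restriction
  have h := uChar_isWheelPoly_even (K₀ := K₀) hω hω1 u (m + 1)
  rw [show 2 * (m + 1) + 2 = (2 * m + 2) + 2 by ring, show 4 * (m + 1) = 4 * m + 4 by ring] at h
  obtain ⟨c', hc', hres⟩ := h.restrict hω (by omega)
  rw [show 2 * (m + 1) - 2 = 2 * m by omega, show 4 * m + 4 - 4 = 4 * m by omega,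
    show 2 * (2 * (m + 1)) - (4 * m + 4) = 0 by omega, pow_zero, one_mul] at *
  obtain ⟨γ, hγ⟩ := IsWheelPoly.proportional_even hω hω1 m (u + 2) hc' (uChar_isWheelPoly_even hω hω1 (u + 2) m)
    (uChar_ne_zero _ _)
  rw [show (2 * m + 2) + 2 = 2 * m + 4 by ring] at hres
  have htop := coeff_top_rapUni_resEta_uChar (K₀ := K₀) ω u (2 * m + 2) (m + 1) (by omega)
  rw [show 2 * m + 2 + 2 = 2 * m + 4 by ring] at htop
  -- evaluate the double sum: the single slice `(m+1, m+1)`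
  set S := spS K₀ u (2 * m + 4) with hS
  have hslice : uCoeff K₀ (u + 1) (m + 1) (uCoeff K₀ u (m + 1) S) = spS K₀ (u + 2) (2 * m + 2) := by
    have h1 := uCoeff_top_spS (K₀ := K₀) u (2 * m + 3)
    rw [show (2 * m + 3) / 2 = m + 1 by omega, show 2 * m + 3 + 1 = 2 * m + 4 by ring] at h1
    have h2 := uCoeff_top_spS (K₀ := K₀) (u + 1) (2 * m + 2)
    rw [show (2 * m + 2) / 2 = m + 1 by omega, show 2 * m + 2 + 1 = 2 * m + 3 by ring, show u + 1 + 1 = u + 2 by ring] at h2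
    rw [h1, h2]
  have hr := uTransfer_spS_succ_exp (K₀ := K₀) u (2 * m + 2) (m + 1) (by omega)
  have hsum : (∑ d ∈ Finset.range (m + 1 + 1), ∑ e ∈ Finset.range (m + 1 + 1),
      if d + e = 2 * m + 2 then genC K₀ ω ^ (m + 1 + e) *
        toRF K₀ (uTransfer K₀ (u + 2) (2 * m + 2) (m + 1) (uCoeff K₀ (u + 1) e (uCoeff K₀ u d S))) else 0) =
      genC K₀ (ω ^ (2 * m + 2)) * ((∏ n ∈ Finset.Ico (u + 2) (u + 2 + (2 * m + 2)), genZ K₀ n) *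
        toRF K₀ (uChar K₀ (u + 2) (2 * m + 2))) := by
    rw [Finset.sum_eq_single_of_mem (m + 1) (by simp) fun d hd hdm =>
      Finset.sum_eq_zero fun e he => if_neg (by
        have := Finset.mem_range.1 hd; have := Finset.mem_range.1 he; omega)]
    rw [Finset.sum_eq_single_of_mem (m + 1) (by simp) fun e he hne => if_neg (by
        have := Finset.mem_range.1 he; omega), if_pos (by ring), hslice, hr, map_mul, map_prod]
    simp only [show ∀ n, toRF K₀ (X n) = genZ K₀ n from fun n => rfl]
    rw [show m + 1 + (m + 1) = 2 * m + 2 by ring]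
    congr 1
    show toRF K₀ (C ω) ^ (2 * m + 2) = toRF K₀ (C (ω ^ (2 * m + 2)))
    rw [map_pow, map_pow]
  rw [hsum] at htop
  have hfree : (C γ * uChar K₀ (u + 2) (2 * m + 2)).degreeOf u = 0 := by
    apply Nat.eq_zero_of_le_zero
    refine (degreeOf_C_mul_le _ _ _).trans ?_
    have := degreeOf_uChar_le (K₀ := K₀) (u + 2) (2 * m + 2) u
    rw [if_neg (by simp)] at this
    exact this
  have htop' : (rapUni K₀ u (resEta K₀ ω u (uChar K₀ u (2 * m + 4)))).coeff (2 * (m + 1) + (2 * m + 2)) =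
      genC K₀ γ * toRF K₀ (uChar K₀ (u + 2) (2 * m + 2)) * ∏ n ∈ Finset.Ico (u + 2) (u + 2 + (2 * m + 2)), genZ K₀ n := by
    rw [hres, hγ, map_mul (rapUni K₀ u), rapUni_eq_C_of_degreeOf_eq_zero hfree, Polynomial.coeff_C_mul,
      show 2 * (m + 1) + (2 * m + 2) = 2 * (2 * m + 2) by ring, coeff_top_rapUni_wheelE, map_mul]
    rfl
  rw [htop'] at htop
  have hne : toRF K₀ (uChar K₀ (u + 2) (2 * m + 2)) * ∏ n ∈ Finset.Ico (u + 2) (u + 2 + (2 * m + 2)), genZ K₀ n ≠ 0 :=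
    mul_ne_zero (fun h0 => uChar_ne_zero (K₀ := K₀) (u + 2) (2 * m + 2) (toRF_injective (h0.trans (map_zero _).symm)))
      (Finset.prod_ne_zero_iff.2 fun n _ => genZ_ne_zero n)
  have hγeq : genC K₀ γ = genC K₀ (ω ^ (2 * m + 2)) := by
    apply mul_right_cancel₀ hne
    rw [← mul_assoc, htop]; ring
  rw [hres, hγ, genC_injective' hγeq]

end Recursion



end Literature.Probability.Percolation
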